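import Literature.InformationTheory.QuantumCodes.BivariateBicycleCodes
import HarnessLib

/-!
# Abelian two-block codes as CSS codes: `d^X = d^Z` and `k = 2·dim(ker A ∩ ker B)` for every finite
# abelian group

The two-block CSS code `H_X = [A|B]`, `H_Z = [Bᵀ|Aᵀ]` with `A = circulant a`, `B = circulant b`
`G`-circulant over a finite **abelian** group `G` (Lin–Pryadko, PRA 109 (2024) 022407, §III–IV
[LinPryadko2024]; Bravyi et al., Nature 627 (2024) §4 [BravyiEtAl2024] for `G = ℤ_ℓ × ℤ_m`) is here
packaged as the tree's `CSSCode` (`AbelianTwoBlock.css a b`), so that the linear algebra PROVED in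
`AbelianTwoBlockCodes.lean` (commutation, `rank H_X = rank H_Z`, `ker H_Zᵀ = ker A ⊓ ker B`, the
weight-preserving `X ↔ Z` transport) yields the CSS PARAMETER statements for every such `G` at once
(qec PARTITION v2.1 D3.5; the `ℤ_ℓ × ℤ_m` case is `BB.Code.dX_eq_dZ` / `k_eq_two_mul_finrank_kerInter`
of `BivariateBicycleCodes.lean`, recovered below by `rfl`):

* `AbelianTwoBlock.css_dX_eq_dZ` : `d^X = d^Z` ([LinPryadko2024, §IV.B: abelian `G` ⇒
  `LP[a,b] ≅ LP[b,a]` ⇒ `d_X = d_Z`]; [BravyiEtAl2024, Lemma 1]). Proved.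
* `AbelianTwoBlock.css_k_eq` : `k = 2 · dim (ker A ⊓ ker B)` ([BravyiEtAl2024, Lemma 1];
  [LinPryadko2024, §IV.E: "the code dimension is even"]). Proved.
* BB corollary: `BB.Code.css_eq` (`QC(A,B).css = AbelianTwoBlock.css (coeffVec A) (coeffVec B)`, `rfl`).

The `2`-GROUP PRUNING LEMMA (`|G| = 2^r` and an odd-weight block ⇒ `k = 0`), being the qec cell's own
result rather than a published statement, lives Summits-side:
`Summits/Ventures/QEC/Census/BB/TwoGroupPruning.lean` (it imports this file).
-/

namespace Literature.InformationTheory.QuantumCodes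

open Matrix

namespace AbelianTwoBlock

variable {G : Type*} [Fintype G] [AddCommGroup G]

/-! ### The CSS code of an abelian two-block pair -/

/-- The abelian two-block code on `(a, b)` as a CSS code presented by check matrices:
`(H_X, H_Z) = ([A|B], [Bᵀ|Aᵀ])`, `A = circulant a`, `B = circulant b`, with the commutation
`H_X H_Zᵀ = 0` proved (`HX_mul_HZ_transpose_eq_zero`).
[cite: LinPryadko2024, §III eq. (10) and §IV (abelian 2BGA codes) (arXiv:2306.16400)] -/
def css (a b : G → ZMod 2) : CSSCode G G (G ⊕ G) :=
  ⟨HX a b, HZ a b, HX_mul_HZ_transpose_eq_zero (by decide) a b⟩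

/-- `(css a b).HX = HX a b`. [cite: LinPryadko2024, §III eq. (10) (arXiv:2306.16400)] -/
@[simp] theorem css_HX (a b : G → ZMod 2) : (css a b).HX = HX a b := rfl

/-- `(css a b).HZ = HZ a b`. [cite: LinPryadko2024, §III eq. (10) (arXiv:2306.16400)] -/
@[simp] theorem css_HZ (a b : G → ZMod 2) : (css a b).HZ = HZ a b := rfl

/-- **`d^X = d^Z` for every abelian two-block code** (the weight-preserving coordinate permutation
`colSwap` exchanges `ker H^Z ∖ rs H^X` and `ker H^X ∖ rs H^Z`). Proved.
[cite: LinPryadko2024, §IV.B (abelian G: LP[a,b] ≅ LP[b,a], hence d_X = d_Z) (arXiv:2306.16400)]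
[cite: BravyiEtAl2024, Lemma 1 "The code offers equal distance for X-type and Z-type errors" (arXiv:2308.07915 chunk p0009 L77)] -/
theorem css_dX_eq_dZ (a b : G → ZMod 2) : (css a b).dX = (css a b).dZ := by
  rw [CSSCode.dZ_eq]
  unfold CSSCode.dX
  congr 1
  refine Set.ext fun w => ⟨?_, ?_⟩
  · rintro ⟨v, ⟨hv, hv'⟩, rfl⟩
    have hv₁ : HZ a b *ᵥ v = 0 := hv
    refine ⟨v ∘ colSwap G, ⟨?_, fun h => hv' ?_⟩, hammingNorm_comp_colSwap v⟩
    · exact (HZ_mulVec_eq_zero_iff a b v).1 hv₁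
    · exact (mem_range_vecMulLinear_HX_iff a b v).2 h
  · rintro ⟨v, ⟨hv, hv'⟩, rfl⟩
    have hv₁ : HX a b *ᵥ v = 0 := hv
    refine ⟨v ∘ colSwap G, ⟨?_, fun h => hv' ?_⟩, hammingNorm_comp_colSwap v⟩
    · exact (HX_mulVec_eq_zero_iff a b v).1 hv₁
    · exact (mem_range_vecMulLinear_HZ_iff a b v).2 h

variable [DecidableEq G]

/-- **`k = 2 · dim (ker A ⊓ ker B)` for every abelian two-block code** (CSS dimension `CSSCode.k`).
Proved (from `two_mul_card_eq_rank_add` and `CSSCode.k_eq`).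
[cite: BravyiEtAl2024, Lemma 1 "k = 2 · dim(ker A ∩ ker B)" (arXiv:2308.07915 chunk p0009 L66–75)]
[cite: LinPryadko2024, §IV.E ("for an abelian group G … the code dimension is even") (arXiv:2306.16400)] -/
theorem css_k_eq (a b : G → ZMod 2) :
    (css a b).k = 2 * Module.finrank (ZMod 2)
      ↥(LinearMap.ker (circulant a).mulVecLin ⊓ LinearMap.ker (circulant b).mulVecLin) := by
  have h := two_mul_card_eq_rank_add (F := ZMod 2) a b
  have hk := (css a b).k_eq
  rw [Fintype.card_sum] at hk
  change (css a b).k = Fintype.card G + Fintype.card G - (HX a b).rank - (HZ a b).rank at hk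
  omega

end AbelianTwoBlock

/-! ### BB corollary (`G = ℤ_ℓ × ℤ_m`) -/

namespace BB.Code

variable {ℓ m : ℕ} [NeZero ℓ] [NeZero m] (C : BB.Code ℓ m)

/-- `QC(A, B).css` is the abelian two-block CSS code of the coefficient vectors (definitional), so every
`AbelianTwoBlock.css_*` statement specialises to BB codes by `rfl`.
[cite: BravyiEtAl2024, §4 (arXiv:2308.07915 chunk p0009 L42–44: special case of the lifted product over the abelian group ℤ_ℓ × ℤ_m)] -/
theorem css_eq : C.css = AbelianTwoBlock.css (coeffVec C.A) (coeffVec C.B) := rfl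

end BB.Code

end Literature.InformationTheory.QuantumCodes
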